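import Mathlib.Algebra.BigOperators.Group.Finset.Basic
import Mathlib.Algebra.BigOperators.Ring.Finset
import Mathlib.Algebra.BigOperators.Field
import Mathlib.Algebra.Order.BigOperators.Group.Finset
import Mathlib.Data.Real.Basic
import Mathlib.Algebra.Order.Archimedean.Real.Basic
import Mathlib.Algebra.Group.Submonoid.Membership
import Mathlib.Algebra.Order.Monoid.Submonoid
import Mathlib.Algebra.Order.Hom.Monoid
import Mathlib.Algebra.Order.Archimedean.Basic
import Mathlib.Order.Hom.Basic
import Mathlib.Tactic.Linarith
import Mathlib.Tactic.Positivity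
import Mathlib.Tactic.FieldSimp
import HarnessLib

/-!
# [IUTchIII] Remark 2.4.2 (ii)–(iv): the weights `r_v`, `r▶_v` and the pilot-element data `(M, η_M)`

Mochizuki, *Inter-universal Teichmüller Theory III*, kurims manuscript (May 2020), §2, Remark 2.4.2,
pp. 89–91 [cite: Mochizuki2012, III Rmk 2.4.2 pp.89–91] (D-0012 claim key, status disputed; the
present remark is elementary real arithmetic and this file takes no side on anything).

Printed text (pp. 89–90), for `v ∈ V̲` lying over `v ∈ V_mod` and `v_ℚ ∈ V_ℚ := V(ℚ)`:

* (ii) `r_v := [(F_mod)_v : ℚ_{v_ℚ}] · log(p_v) ∈ ℝ` if `v ∈ V̲^good`,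
  `r_v := [(F_mod)_v : ℚ_{v_ℚ}] · ord_v(q_v) · log(p_v) ∈ ℝ` if `v ∈ V̲^bad` — where `ord_v` is the
  `p_v`-adic valuation normalised by `ord_v(p_v) = 1` and `q_v` is the `q`-parameter of [IUTchI]
  Example 3.2 (iv) — and `r▶_v := − r_v / Σ_{w ∈ V̲^bad} r_w`. (For `v` archimedean `p_v = e`, so
  `log(p_v) = 1` [IUTchI, §0 "Numbers", p. 36].)
* (iii) "let `M` be any ordered monoid isomorphic [as an ordered monoid] to `ℝ` … Then `M` naturally
  determines a collection of data `(M, {M_v}_{v∈V̲}, {ρ_{M_v} : M_v ⥲ M}_{v∈V̲})` as follows: for each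
  `v ∈ V̲`, we take `M_v` to be a copy of `M` and `ρ_{M_v} : M_v ⥲ M` to be the isomorphism of monoids
  [that reverses the ordering!] given by multiplying by `r▶_v ∈ ℝ`."
* (iv) given a *pilot element* `η_M ∈ M`, `η_M < 0`: "`M▶_v ⊆ M_v` [is] the submonoid [isomorphic to
  `ℕ`] generated by `η_{M_v}`" for `v ∈ V̲^non`, "the submonoid [isomorphic to `ℝ_{≥0}`] given by the
  elements `≤ 0`" for `v ∈ V̲^arc`, `ρ_{M▶_v}` the restriction of `ρ_{M_v}`, and
  "`ρ_{M▶_v}(η_{M_v}) = r▶_v · η_M` for each `v ∈ V̲`."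

Design. The number-theoretic inputs (`V̲` finite with its bad / archimedean places, the local
degrees, `log p_v`, `ord_v(q_v)`) enter as the fields of `PlaceWeights` — real numbers with the
sign/normalisation properties the text uses; the initial Θ-data producing them is [IUTchI] Def 3.1
(owner: abc-iut-L5-t2, TODO-merge). In (iii) we IDENTIFY `M` with `ℝ` along a chosen ordered-monoid
isomorphism (the text's "copy of `M`"); that the construction does not depend on the choice is the
content of `orderAddMonoidIso_real_apply` (an order-preserving additive automorphism of `ℝ` is
`x ↦ c·x` with `c > 0`, hence commutes with "multiplying by `r▶_v`").

PROVED here: `r_pos`, `sum_bad_pos`, `rTri_neg` (the weights are positive, `r▶_v < 0` — the reason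
`ρ_{M_v}` "reverses the ordering"), `sum_bad_rTri` (`Σ_{w bad} r▶_w = −1`), `rho_strictAnti`,
`rho_bijective`, `rho_eta` (= the displayed `ρ_{M▶_v}(η_{M_v}) = r▶_v · η_M`), `mem_MTri_non_iff`
(`M▶_v = ℕ·η`), `eta_mem_MTri`, `rho_MTri_nonneg` (`ρ` maps `M▶_v` into the elements `≥ 0`).
NOT here: (i), (v), (vi) of Rmk 2.4.2 (pilot objects of `F^{⊩▶}`-prime-strips and the reconstruction
of `(*C^⊩, Prime(*C^⊩) ⥲ V̲, …)` from `Pic(*C^⊩)` via [FrdI] Thm 5.1 / 6.4) — they need the global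
realified Frobenioid interface of `Literature/AlgebraicGeometry/Frobenioids/` (abc-iut-L1) and the
prime-strip file `PrimeStripsPerp.lean` of this directory (Def 2.4); recorded there.
-/

namespace Literature.IUT.LogThetaLattice

open Finset

/-! ### (ii) The weights `r_v` and `r▶_v` -/

/-- The local numerical data of Remark 2.4.2 (ii) at the places `v ∈ V̲` of the initial Θ-data
[IUTchI, Def 3.1]: which places are bad (`V̲^bad`, nonempty, nonarchimedean) and which archimedean,
the local degree `[(F_mod)_v : ℚ_{v_ℚ}] ≥ 1`, the real number `log(p_v) > 0` (`= 1` at archimedean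
`v`, where `p_v = e`), and `ord_v(q_v) > 0` at bad `v` (the `q`-parameter has positive valuation).
INTERFACE for [IUTchI] Def 3.1 / Ex 3.2 (iv) (TODO-merge: abc-iut-L5-t2).
[cite: Mochizuki2012, III Rmk 2.4.2 (ii) p.89] -/
structure PlaceWeights (V : Type*) [Fintype V] where
  /-- `v ∈ V̲^bad` -/
  isBad : V → Prop
  /-- `v ∈ V̲^arc` -/
  isArc : V → Prop
  [decBad : DecidablePred isBad]
  [decArc : DecidablePred isArc]
  /-- bad places are nonarchimedean [IUTchI, Def 3.1 (b)] -/
  not_isArc_of_isBad : ∀ v, isBad v → ¬ isArc v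
  /-- `V̲^bad` is nonempty [IUTchI, Def 3.1 (b)] -/
  exists_isBad : ∃ v, isBad v
  /-- the local degree `[(F_mod)_v : ℚ_{v_ℚ}]` -/
  deg : V → ℕ
  /-- local degrees are positive -/
  deg_pos : ∀ v, 0 < deg v
  /-- `log(p_v)` -/
  logp : V → ℝ
  /-- `log(p_v) > 0` (`p_v ≥ 2` nonarchimedean, `p_v = e` archimedean) -/
  logp_pos : ∀ v, 0 < logp v
  /-- at archimedean `v`, `p_v = e` so `log(p_v) = 1` [IUTchI, §0 p.36] -/
  logp_arc : ∀ v, isArc v → logp v = 1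
  /-- `ord_v(q_v)` at bad `v` (unused elsewhere) -/
  ordq : V → ℚ
  /-- the `q`-parameter at a bad place has positive valuation -/
  ordq_pos : ∀ v, isBad v → 0 < ordq v

namespace PlaceWeights

variable {V : Type*} [Fintype V] (W : PlaceWeights V)

attribute [instance] PlaceWeights.decBad PlaceWeights.decArc

/-- `r_v := [(F_mod)_v : ℚ_{v_ℚ}] · log(p_v)` at good `v`, `:= [(F_mod)_v : ℚ_{v_ℚ}] · ord_v(q_v) · log(p_v)`
at bad `v`. [cite: Mochizuki2012, III Rmk 2.4.2 (ii) p.89] -/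
noncomputable def r (v : V) : ℝ :=
  if W.isBad v then (W.deg v : ℝ) * (W.ordq v : ℝ) * W.logp v else (W.deg v : ℝ) * W.logp v

/-- The finite set `V̲^bad` of bad places. [cite: Mochizuki2012, III Rmk 2.4.2 (ii) p.89] -/
def badPlaces : Finset V := univ.filter W.isBad

/-- `r▶_v := − r_v / Σ_{w ∈ V̲^bad} r_w`. [cite: Mochizuki2012, III Rmk 2.4.2 (ii) p.89] -/
noncomputable def rTri (v : V) : ℝ := - W.r v / ∑ w ∈ W.badPlaces, W.r w

/-- Every weight `r_v` is positive. [cite: Mochizuki2012, III Rmk 2.4.2 (ii) p.89] -/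
theorem r_pos (v : V) : 0 < W.r v := by
  unfold r
  have h1 : (0 : ℝ) < W.deg v := by exact_mod_cast W.deg_pos v
  have h2 := W.logp_pos v
  split_ifs with hb
  · have h3 : (0 : ℝ) < W.ordq v := by exact_mod_cast W.ordq_pos v hb
    positivity
  · positivity

/-- At an archimedean place `r_v = [(F_mod)_v : ℝ]` (since `log(p_v) = log e = 1` and `v` is good).
[cite: Mochizuki2012, III Rmk 2.4.2 (ii) p.89] -/
theorem r_arc (v : V) (hv : W.isArc v) : W.r v = W.deg v := by
  unfold r
  rw [if_neg (fun hb => W.not_isArc_of_isBad v hb hv), W.logp_arc v hv, mul_one]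

/-- The denominator `Σ_{w ∈ V̲^bad} r_w` is positive (`V̲^bad ≠ ∅`). [cite: Mochizuki2012, III Rmk 2.4.2 (ii) p.89] -/
theorem sum_bad_pos : 0 < ∑ w ∈ W.badPlaces, W.r w := by
  obtain ⟨v, hv⟩ := W.exists_isBad
  have hmem : v ∈ W.badPlaces := by simp [badPlaces, hv]
  exact Finset.sum_pos' (fun w _ => (W.r_pos w).le) ⟨v, hmem, W.r_pos v⟩

/-- `r▶_v < 0` for every `v` — which is why "multiplying by `r▶_v`" reverses the ordering in (iii).
[cite: Mochizuki2012, III Rmk 2.4.2 (iii) p.90] -/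
theorem rTri_neg (v : V) : W.rTri v < 0 := by
  unfold rTri
  exact div_neg_of_neg_of_pos (neg_neg_of_pos (W.r_pos v)) W.sum_bad_pos

/-- `r▶_v ≠ 0`. [cite: Mochizuki2012, III Rmk 2.4.2 (ii) p.89] -/
theorem rTri_ne_zero (v : V) : W.rTri v ≠ 0 := (W.rTri_neg v).ne

/-- The normalisation built into `r▶`: `Σ_{w ∈ V̲^bad} r▶_w = −1`. [cite: Mochizuki2012, III Rmk 2.4.2 (ii) p.89] -/
theorem sum_bad_rTri : ∑ w ∈ W.badPlaces, W.rTri w = -1 := by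
  unfold rTri
  rw [← Finset.sum_div, Finset.sum_neg_distrib, neg_div, div_self W.sum_bad_pos.ne']

/-! ### (iii) The datum `(M, {M_v}, {ρ_{M_v}})`, with `M` identified with `ℝ` -/

/-- `ρ_{M_v} : M_v → M`, "the isomorphism of monoids [that reverses the ordering!] given by
multiplying by `r▶_v ∈ ℝ`" — with `M` and its copy `M_v` both identified with `ℝ`.
[cite: Mochizuki2012, III Rmk 2.4.2 (iii) p.90] -/
noncomputable def rho (v : V) : ℝ →+ ℝ := AddMonoidHom.mulLeft (W.rTri v)

/-- `ρ_{M_v}(x) = r▶_v · x`. [cite: Mochizuki2012, III Rmk 2.4.2 (iii) p.90] -/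
@[simp] theorem rho_apply (v : V) (x : ℝ) : W.rho v x = W.rTri v * x := rfl

/-- `ρ_{M_v}` "reverses the ordering": it is strictly antitone. [cite: Mochizuki2012, III Rmk 2.4.2 (iii) p.90] -/
theorem rho_strictAnti (v : V) : StrictAnti (W.rho v) := fun x y hxy => by
  simp only [rho_apply]
  exact mul_lt_mul_of_neg_left hxy (W.rTri_neg v)

/-- `ρ_{M_v}` is an isomorphism of monoids (bijective additive map). [cite: Mochizuki2012, III Rmk 2.4.2 (iii) p.90] -/
theorem rho_bijective (v : V) : Function.Bijective (W.rho v) := by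
  constructor
  · exact (W.rho_strictAnti v).injective
  · intro y
    refine ⟨y / W.rTri v, ?_⟩
    simp only [rho_apply]
    field_simp [W.rTri_ne_zero v]

/-- `ρ_{M_v}` packaged as an isomorphism of ordered monoids `M_v ⥲ Mᵒᵈ` onto the order-dual of `M`
("reverses the ordering"). [cite: Mochizuki2012, III Rmk 2.4.2 (iii) p.90] -/
noncomputable def rhoOrderIso (v : V) : ℝ ≃+o ℝᵒᵈ where
  toFun x := OrderDual.toDual (W.rho v x)
  invFun y := OrderDual.ofDual y / W.rTri v
  left_inv x := by
    simp only [rho_apply, OrderDual.ofDual_toDual]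
    field_simp [W.rTri_ne_zero v]
  right_inv y := by
    simp only [rho_apply]
    rw [mul_div_cancel₀ _ (W.rTri_ne_zero v), OrderDual.toDual_ofDual]
  map_add' x y := by
    simp only [rho_apply, mul_add]; rfl
  map_le_map_iff' := by
    intro x y
    simp only [rho_apply, OrderDual.toDual_le_toDual]
    exact mul_le_mul_left_of_neg (W.rTri_neg v)

/-- Underlying map of `rhoOrderIso`. [cite: Mochizuki2012, III Rmk 2.4.2 (iii) p.90] -/
@[simp] theorem rhoOrderIso_apply (v : V) (x : ℝ) :
    OrderDual.ofDual (W.rhoOrderIso v x) = W.rTri v * x := rfl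

/-! ### (iv) Pilot elements and the submonoids `M▶_v` -/

/-- The additive submonoid of nonpositive reals ("the elements `≤ 0`", "[isomorphic to `ℝ_{≥0}`]").
[cite: Mochizuki2012, III Rmk 2.4.2 (iv) p.90] -/
def nonposReal : AddSubmonoid ℝ where
  carrier := {x | x ≤ 0}
  add_mem' := fun {a b} (ha : a ≤ 0) (hb : b ≤ 0) => show a + b ≤ 0 from add_nonpos ha hb
  zero_mem' := show (0 : ℝ) ≤ 0 from le_rfl

/-- Membership in `nonposReal`. [cite: Mochizuki2012, III Rmk 2.4.2 (iv) p.90] -/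
@[simp] theorem mem_nonposReal (x : ℝ) : x ∈ nonposReal ↔ x ≤ 0 := Iff.rfl

/-- The submonoid `M▶_v ⊆ M_v` attached to a pilot element `η` [cite: Mochizuki2012, III Rmk 2.4.2 (iv) p.90]:
for `v ∈ V̲^non` "the submonoid [isomorphic to `ℕ`] generated by `η_{M_v}`", for `v ∈ V̲^arc` "the
submonoid [isomorphic to `ℝ_{≥0}`] given by the elements `≤ 0`" (with `M_v` identified with `ℝ`). -/
noncomputable def MTri (η : ℝ) (v : V) : AddSubmonoid ℝ :=
  if W.isArc v then nonposReal else AddSubmonoid.closure {η}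

/-- At an archimedean place `M▶_v` is the monoid of elements `≤ 0`. [cite: Mochizuki2012, III Rmk 2.4.2 (iv) p.90] -/
theorem mem_MTri_arc_iff {η : ℝ} {v : V} (hv : W.isArc v) (x : ℝ) : x ∈ W.MTri η v ↔ x ≤ 0 := by
  rw [MTri, if_pos hv, mem_nonposReal]

/-- At a nonarchimedean place `M▶_v = {n · η | n ∈ ℕ}`. [cite: Mochizuki2012, III Rmk 2.4.2 (iv) p.90] -/
theorem mem_MTri_non_iff {η : ℝ} {v : V} (hv : ¬ W.isArc v) (x : ℝ) :
    x ∈ W.MTri η v ↔ ∃ n : ℕ, n • η = x := by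
  rw [MTri, if_neg hv, AddSubmonoid.mem_closure_singleton]

/-- At a nonarchimedean place and for `η ≠ 0` the map `n ↦ n · η` is a bijection `ℕ ⥲ M▶_v`
("[isomorphic to `ℕ`]"). [cite: Mochizuki2012, III Rmk 2.4.2 (iv) p.90] -/
theorem MTri_non_bijective {η : ℝ} (hη : η ≠ 0) {v : V} (hv : ¬ W.isArc v) :
    Function.Bijective (fun n : ℕ => (⟨n • η, (W.mem_MTri_non_iff hv _).mpr ⟨n, rfl⟩⟩ : W.MTri η v)) := by
  constructor
  · intro a b hab
    have h : (a : ℝ) * η = (b : ℝ) * η := by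
      simpa [nsmul_eq_mul] using congrArg Subtype.val hab
    exact_mod_cast mul_right_cancel₀ hη h
  · rintro ⟨x, hx⟩
    obtain ⟨n, rfl⟩ := (W.mem_MTri_non_iff hv x).mp hx
    exact ⟨n, rfl⟩

/-- A (negative) pilot element lies in every `M▶_v`. [cite: Mochizuki2012, III Rmk 2.4.2 (iv) p.90] -/
theorem eta_mem_MTri {η : ℝ} (hη : η < 0) (v : V) : η ∈ W.MTri η v := by
  by_cases hv : W.isArc v
  · exact (W.mem_MTri_arc_iff hv η).mpr hη.le
  · exact (W.mem_MTri_non_iff hv η).mpr ⟨1, one_nsmul η⟩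

/-- Every element of `M▶_v` is `≤ 0` when the pilot element is negative. [cite: Mochizuki2012, III Rmk 2.4.2 (iv) p.90] -/
theorem nonpos_of_mem_MTri {η : ℝ} (hη : η < 0) {v : V} {x : ℝ} (hx : x ∈ W.MTri η v) : x ≤ 0 := by
  by_cases hv : W.isArc v
  · exact (W.mem_MTri_arc_iff hv x).mp hx
  · obtain ⟨n, rfl⟩ := (W.mem_MTri_non_iff hv x).mp hx
    rw [nsmul_eq_mul]
    exact mul_nonpos_of_nonneg_of_nonpos n.cast_nonneg hη.le

/-- **The displayed formula of Rmk 2.4.2 (iv): `ρ_{M▶_v}(η_{M_v}) = r▶_v · η_M` for each `v ∈ V̲`**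
(`ρ_{M▶_v}` being the restriction of `ρ_{M_v}`). [cite: Mochizuki2012, III Rmk 2.4.2 (iv) p.90] -/
theorem rho_eta (η : ℝ) (v : V) : W.rho v η = W.rTri v * η := rfl

/-- `ρ_{M▶_v} : M▶_v ↪ M` lands in the nonnegative elements (a negative pilot times the negative `r▶_v`);
in particular `ρ_{M▶_v}(η_{M_v}) > 0`. [cite: Mochizuki2012, III Rmk 2.4.2 (iv) p.90] -/
theorem rho_MTri_nonneg {η : ℝ} (hη : η < 0) {v : V} {x : ℝ} (hx : x ∈ W.MTri η v) : 0 ≤ W.rho v x := by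
  rw [rho_apply]
  exact mul_nonneg_of_nonpos_of_nonpos (W.rTri_neg v).le (W.nonpos_of_mem_MTri hη hx)

/-- `ρ_{M▶_v}(η_{M_v}) = r▶_v · η_M > 0` for a pilot element `η_M < 0`. [cite: Mochizuki2012, III Rmk 2.4.2 (iv) p.90] -/
theorem rho_eta_pos {η : ℝ} (hη : η < 0) (v : V) : 0 < W.rho v η := by
  rw [rho_apply]; exact mul_pos_of_neg_of_neg (W.rTri_neg v) hη

/-- Summing the images of the pilot element over the bad places recovers `−η_M`:
`Σ_{w ∈ V̲^bad} ρ_{M_w}(η_{M_w}) = −η_M` (from `Σ_{w bad} r▶_w = −1`). [cite: Mochizuki2012, III Rmk 2.4.2 (ii)–(iv) pp.89–90] -/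
theorem sum_bad_rho_eta (η : ℝ) : ∑ w ∈ W.badPlaces, W.rho w η = -η := by
  simp only [rho_apply]
  rw [← Finset.sum_mul, sum_bad_rTri, neg_one_mul]

end PlaceWeights

/-! ### Independence of the identification `M ≅ ℝ` in (iii) -/

/-- An order-preserving additive automorphism of `ℝ` is multiplication by the positive real `e 1`.
Consequently the construction "multiply by `r▶_v`" on an ordered monoid `M ≅ ℝ` of Rmk 2.4.2 (iii)
does not depend on the chosen identification `M ⥲ ℝ` (the two identifications differ by such an
automorphism, which commutes with real scalings). [cite: Mochizuki2012, III Rmk 2.4.2 (iii) p.89] -/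
theorem orderAddMonoidIso_real_apply (e : ℝ ≃+o ℝ) (x : ℝ) : e x = e 1 * x := by
  -- `e` is additive and monotone, hence `ℚ`-linear and, by density + monotonicity, `ℝ`-linear.
  have hmono : Monotone e := fun a b h => (map_le_map_iff e).mpr h
  have hadd : ∀ a b, e (a + b) = e a + e b := fun a b => map_add e a b
  -- ℚ-homogeneity
  have hnat : ∀ (n : ℕ) (y : ℝ), e (n * y) = n * e y := by
    intro n y
    induction n with
    | zero => simp
    | succ k ih => rw [Nat.cast_succ, add_mul, one_mul, hadd, ih, add_mul, one_mul]
  have hint : ∀ (n : ℤ) (y : ℝ), e (n * y) = n * e y := by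
    intro n y
    obtain ⟨m, rfl | rfl⟩ := Int.eq_nat_or_neg n
    · exact_mod_cast hnat m y
    · have := hnat m y
      simp only [Int.cast_neg, Int.cast_natCast, neg_mul]
      rw [map_neg, this]
  have hrat : ∀ (q : ℚ) (y : ℝ), e (q * y) = q * e y := by
    intro q y
    have hq : (q.den : ℝ) ≠ 0 := by exact_mod_cast q.den_ne_zero
    have h1 : e ((q.num : ℝ) * (y / q.den)) = q.num * e (y / q.den) := hint q.num _
    have h2 : e y = q.den * e (y / q.den) := by
      rw [← hnat]; congr 1; field_simp
    rw [Rat.cast_def, div_mul_eq_mul_div, mul_div_assoc, h1, h2]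
    field_simp
  -- e 1 > 0
  have he1 : 0 < e 1 := by
    have : e 0 < e 1 := (hmono.strictMono_of_injective e.injective) one_pos
    simpa using this
  -- squeeze by rationals
  apply le_antisymm
  · -- e x ≤ e 1 * x : for every rational q > x, e x ≤ e q = q * e 1
    by_contra hlt
    rw [not_le] at hlt
    obtain ⟨q, hxq, hq⟩ := exists_rat_btwn (show x < e x / e 1 by
      rw [lt_div_iff₀ he1]; linarith [mul_comm (e 1) x])
    have h1 : e x ≤ e q := hmono hxq.le
    rw [show (q : ℝ) = q * 1 by ring, hrat] at h1
    rw [lt_div_iff₀ he1] at hq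
    linarith
  · by_contra hlt
    rw [not_le] at hlt
    obtain ⟨q, hq, hqx⟩ := exists_rat_btwn (show e x / e 1 < x by
      rw [div_lt_iff₀ he1]; linarith [mul_comm (e 1) x])
    have h1 : e q ≤ e x := hmono hqx.le
    rw [show (q : ℝ) = q * 1 by ring, hrat] at h1
    rw [div_lt_iff₀ he1] at hq
    linarith

/-- Corollary: any two identifications of an ordered monoid with `ℝ` differ by a positive scaling,
so "multiplication by `r ∈ ℝ`" transported along either gives the same map: for `e : ℝ ≃+o ℝ`,
`e (r · e⁻¹ x) = r · x`. [cite: Mochizuki2012, III Rmk 2.4.2 (iii) p.89] -/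
theorem orderAddMonoidIso_real_conj_smul (e : ℝ ≃+o ℝ) (r x : ℝ) : e (r * e.symm x) = r * x := by
  rw [orderAddMonoidIso_real_apply e, ← mul_assoc, mul_comm (e 1) r, mul_assoc,
    ← orderAddMonoidIso_real_apply e, OrderAddMonoidIso.apply_symm_apply]

end Literature.IUT.LogThetaLattice
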